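import Summits.ValiantsHypothesis.ValiantsHypothesis.Theorems.BarrierLeverDefinableEquationsUnipotentNormalForm

/-!
# Cruxes `BarrierLever.DefinableEquations` (8745) / `SingleSizeEquations` (8749) — the `U`-invariant
# extraction keeps TOP SUPPORT

Companion to `…UnipotentNormalForm.lean` (design memo `HWV-NORMAL-FORM-PLAN.md`, evidence #9 on
stmt-ValiantsHypothesis-8749).  A witness `E` is TOP-SUPPORTED if it involves only the coefficient
variables `c_m` with `|m| = n` (the coordinates of `Sym^n ℂ^n`; normal form of
`…TopEquations.lean`).  THEOREM (`uEq_of_eq_top`): the `U`-invariant witness produced by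
`uEq_of_eq` from a top-supported witness is top-supported.  Mechanism: the coefficient action
`T_s` of a unitriangular substitution is block-triangular by degree — the top coefficients of
`f_c ∘ u_s` only depend on the top coefficients of `f_c` (`uAct_killLow_of_top`) — so the generic
translate `G(s, c) = E(T_s c)` of a top-supported `E` satisfies `G = G ∘ killLow` as polynomials
(`aeval_killLowSubst_eq`, by `MvPolynomial.funext`), hence involves only top coefficient variables
(`top_of_mem_vars`, via `vars_bind₁`), and so do its weight components and their specialisations
(`top_of_specialisation`).

Elementary; small definitions (`killLow`, `killLowSubst` abbreviate explicit expressions), no named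
facts.  HONEST FRAMING: bookkeeping for a normal form; nothing here bears on the open content of
the cruxes.  References: [LandsbergGCT2017] §8; [ForbesShpilkaVolk2018] Def. 1.
-/

-- layout Summits/ValiantsHypothesis/ValiantsHypothesis forces the duplicated namespace component
set_option linter.dupNamespace false

noncomputable section

open MvPolynomial

namespace Summit.ValiantsHypothesis.ValiantsHypothesis.Theorems.BarrierLever.IsobaricEquations

open Literature.Computability.AlgebraicComplexity Literature.Barriers.ValiantsHypothesis
open Summit.ValiantsHypothesis.ValiantsHypothesis.Theorems.BarrierLever.SuccinctHittingSetsForVP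
open Summit.ValiantsHypothesis.ValiantsHypothesis.Theorems.BarrierLever.BoolSumComponents

/-! ## §13 The `U`-step keeps TOP SUPPORT (witnesses involving only `c_m`, `|m| = n`) -/

section top

variable {n : ℕ}

/-- A polynomial whose monomials only involve "top" variables takes the same value at two points
that agree on the top variables. [folklore] -/
theorem eval_eq_of_top {E : MvPolynomial (degLEMonomials n) ℂ}
    (htop : ∀ α ∈ E.support, ∀ m ∈ α.support, ((m : degLEMonomials n) : Fin n →₀ ℕ).degree = n)
    {c c' : degLEMonomials n → ℂ}
    (hcc' : ∀ m : degLEMonomials n, ((m : degLEMonomials n) : Fin n →₀ ℕ).degree = n → c m = c' m) :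
    eval c E = eval c' E := by
  rw [eval_eq, eval_eq]
  refine Finset.sum_congr rfl fun α hα => ?_
  congr 1
  exact Finset.prod_congr rfl fun m hm => by rw [hcc' m (htop α hα m hm)]

variable [Fintype (degLEMonomials n)]

/-- Killing the non-top coordinates of a coefficient vector. [folklore] -/
def killLow (c : degLEMonomials n → ℂ) : degLEMonomials n → ℂ :=
  fun m => if ((m : degLEMonomials n) : Fin n →₀ ℕ).degree = n then c m else 0

/-- `f_c` is additive in `c`. [folklore] -/
theorem ofCoeffs_sub (c c' : degLEMonomials n → ℂ) :
    ofCoeffs (fun m => c m - c' m) = ofCoeffs c - ofCoeffs c' := by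
  unfold ofCoeffs
  rw [← Finset.sum_sub_distrib]
  exact Finset.sum_congr rfl fun m _ => by rw [← map_sub]

/-- The low part `f_c - f_{killLow c}` has degree `< n` (`n ≥ 1`). [folklore] -/
theorem totalDegree_ofCoeffs_low_lt (hn : 1 ≤ n) (c : degLEMonomials n → ℂ) :
    (ofCoeffs (fun m => c m - killLow c m)).totalDegree < n := by
  classical
  unfold ofCoeffs
  refine Nat.lt_of_le_of_lt (totalDegree_finsetSum_le (d := n - 1) fun m _ => ?_) (by omega)
  by_cases hm : ((m : degLEMonomials n) : Fin n →₀ ℕ).degree = n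
  · have h0 : c m - killLow c m = 0 := by rw [killLow, if_pos hm, sub_self]
    rw [show (fun m => c m - killLow c m) m = c m - killLow c m from rfl, h0, map_zero,
      totalDegree_zero]
    exact Nat.zero_le _
  · refine (totalDegree_monomial_le _ _).trans ?_
    have h := m.2
    simp only [degLEMonomials, Set.mem_setOf_eq] at h
    have hlt : ((m : degLEMonomials n) : Fin n →₀ ℕ).degree ≤ n - 1 := by omega
    rw [Finsupp.degree_apply] at hlt
    exact hlt

/-- **The coefficient action is block-triangular by degree**: the top coefficients of `f_c ∘ u_s`
only depend on the top coefficients of `f_c`. [folklore] -/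
theorem uAct_killLow_of_top (hn : 1 ≤ n) (s : Fin n → Fin n → ℂ) (c : degLEMonomials n → ℂ)
    (m : degLEMonomials n) (hm : ((m : degLEMonomials n) : Fin n →₀ ℕ).degree = n) :
    uAct s c m = uAct s (killLow c) m := by
  rw [uAct_apply, uAct_apply, ← sub_eq_zero, ← coeff_sub, ← map_sub, ← ofCoeffs_sub]
  refine coeff_eq_zero_of_totalDegree_lt ?_
  refine lt_of_lt_of_le ((totalDegree_aeval_unip_le s _).trans_lt
    (totalDegree_ofCoeffs_low_lt hn c)) ?_
  rw [← Finsupp.degree_apply]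
  exact hm.ge

/-- The substitution killing the non-top coefficient variables (the `s`-variables fixed).
[folklore] -/
def killLowSubst (n : ℕ) :
    (Fin n × Fin n) ⊕ degLEMonomials n → MvPolynomial ((Fin n × Fin n) ⊕ degLEMonomials n) ℂ
  | Sum.inl p => X (Sum.inl p)
  | Sum.inr m => if ((m : degLEMonomials n) : Fin n →₀ ℕ).degree = n then X (Sum.inr m) else 0

/-- **A generic translate of a top-supported equation only involves top coefficient variables**:
`G = G ∘ killLow` as polynomials. [folklore] -/
theorem aeval_killLowSubst_eq (hn : 1 ≤ n) {G : MvPolynomial ((Fin n × Fin n) ⊕ degLEMonomials n) ℂ}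
    {E : MvPolynomial (degLEMonomials n) ℂ}
    (hG : ∀ (s : Fin n → Fin n → ℂ) (c : degLEMonomials n → ℂ), eval (spt s c) G = eval (uAct s c) E)
    (htop : ∀ α ∈ E.support, ∀ m ∈ α.support, ((m : degLEMonomials n) : Fin n →₀ ℕ).degree = n) :
    aeval (killLowSubst n) G = G := by
  refine MvPolynomial.funext fun x => ?_
  have hpt : (fun v => eval x (killLowSubst n v)) =
      spt (fun i j => x (Sum.inl (i, j))) (killLow (x ∘ Sum.inr)) := by
    funext v
    rcases v with ⟨i, j⟩ | m
    · rw [killLowSubst, eval_X]; rfl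
    · rw [killLowSubst, spt, Sum.elim_inr, killLow]
      split_ifs
      · rw [eval_X]; rfl
      · rw [map_zero]
  rw [BoolSumComponents.eval_aeval_eq, hpt, hG, ← spt_eta x, hG, spt_eta]
  refine (eval_eq_of_top htop fun m hm => ?_).symm
  exact uAct_killLow_of_top hn _ _ m hm

/-- Hence every coefficient variable occurring in such a `G` is a top one. [folklore] -/
theorem top_of_mem_vars (hn : 1 ≤ n) {G : MvPolynomial ((Fin n × Fin n) ⊕ degLEMonomials n) ℂ}
    {E : MvPolynomial (degLEMonomials n) ℂ}
    (hG : ∀ (s : Fin n → Fin n → ℂ) (c : degLEMonomials n → ℂ), eval (spt s c) G = eval (uAct s c) E)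
    (htop : ∀ α ∈ E.support, ∀ m ∈ α.support, ((m : degLEMonomials n) : Fin n →₀ ℕ).degree = n)
    {m : degLEMonomials n} (hm : (Sum.inr m : (Fin n × Fin n) ⊕ degLEMonomials n) ∈ G.vars) :
    ((m : degLEMonomials n) : Fin n →₀ ℕ).degree = n := by
  classical
  rw [← aeval_killLowSubst_eq hn hG htop, show aeval (killLowSubst n) G = bind₁ (killLowSubst n) G
    from rfl] at hm
  obtain ⟨v, -, hv⟩ := Finset.mem_biUnion.mp (vars_bind₁ _ _ hm)
  rcases v with p | m'
  · rw [killLowSubst, vars_X, Finset.mem_singleton] at hv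
    exact absurd hv (by simp)
  · rw [killLowSubst] at hv
    by_cases h : ((m' : degLEMonomials n) : Fin n →₀ ℕ).degree = n
    · rw [if_pos h, vars_X, Finset.mem_singleton] at hv
      rw [Sum.inr_injective hv]; exact h
    · rw [if_neg h, vars_0] at hv
      exact absurd hv (Finset.notMem_empty _)

/-- **Top support of the extracted witness**: if `E` is top-supported, `G` as above, `P` any
polynomial with `P.support ⊆ G.support` (e.g. a weight component of `G`), then the specialisation
`P(s₀, ·)` is top-supported. [folklore] -/
theorem top_of_specialisation (hn : 1 ≤ n) {G P : MvPolynomial ((Fin n × Fin n) ⊕ degLEMonomials n) ℂ}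
    {E : MvPolynomial (degLEMonomials n) ℂ}
    (hG : ∀ (s : Fin n → Fin n → ℂ) (c : degLEMonomials n → ℂ), eval (spt s c) G = eval (uAct s c) E)
    (htop : ∀ α ∈ E.support, ∀ m ∈ α.support, ((m : degLEMonomials n) : Fin n →₀ ℕ).degree = n)
    (hP : P.support ⊆ G.support) (s₀ : Fin n × Fin n → ℂ) :
    ∀ α ∈ (aeval (Sum.elim (fun p => C (s₀ p)) X :
        (Fin n × Fin n) ⊕ degLEMonomials n → MvPolynomial (degLEMonomials n) ℂ) P).support,
      ∀ m ∈ α.support, ((m : degLEMonomials n) : Fin n →₀ ℕ).degree = n := by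
  classical
  intro α hα m hm
  have hmv : m ∈ (aeval (Sum.elim (fun p => C (s₀ p)) X :
      (Fin n × Fin n) ⊕ degLEMonomials n → MvPolynomial (degLEMonomials n) ℂ) P).vars :=
    (mem_vars_iff_mem_support m).mpr ⟨α, hα, hm⟩
  rw [show aeval _ P = bind₁ (Sum.elim (fun p => C (s₀ p)) X :
      (Fin n × Fin n) ⊕ degLEMonomials n → MvPolynomial (degLEMonomials n) ℂ) P from rfl] at hmv
  obtain ⟨v, hv, hmv'⟩ := Finset.mem_biUnion.mp (vars_bind₁ _ _ hmv)
  rcases v with p | m'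
  · rw [Sum.elim_inl, vars_C] at hmv'
    exact absurd hmv' (Finset.notMem_empty _)
  · rw [Sum.elim_inr, vars_X, Finset.mem_singleton] at hmv'
    subst hmv'
    refine top_of_mem_vars hn hG htop ?_
    obtain ⟨β, hβ, hm'β⟩ := (mem_vars_iff_mem_support _).mp hv
    exact (mem_vars_iff_mem_support _).mpr ⟨β, hP hβ, hm'β⟩

end top

section utop

variable {n : ℕ}

/-- **`uEq_of_eq` with top support tracking**: the `U`-invariant witness extracted from a
top-supported witness (only the coefficient variables `c_m`, `|m| = n`, occur) is top-supported.
[folklore] -/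
theorem uEq_of_eq_top [Fintype (degLEMonomials n)] {a b : ℕ} (hn : 64 ≤ n) (ha : 2 * a + 6 ≤ n)
    {q : ℕ} (hq : q ≤ (Nat.choose (2 * n) n) ^ a) (H : MvPolynomial (↥(degLEMonomials n) ⊕ Fin q) ℂ)
    (hc : complexity H ≤ (Nat.choose (2 * n) n) ^ a) (hd : H.totalDegree ≤ (Nat.choose (2 * n) n) ^ a)
    (hne : boolSum H ≠ 0)
    (hvan : ∀ f ∈ SmallCircuits ℂ n (b + 3), eval (coeffVector (degLEMonomials n) f) (boolSum H) = 0) :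
    ∃ q' : ℕ, q' ≤ (Nat.choose (2 * n) n) ^ (a + 4) ∧
      ∃ H' : MvPolynomial (↥(degLEMonomials n) ⊕ Fin q') ℂ,
        complexity H' ≤ (Nat.choose (2 * n) n) ^ (a + 4) ∧
        H'.totalDegree ≤ (Nat.choose (2 * n) n) ^ (a + 4) ∧ boolSum H' ≠ 0 ∧
        (∀ f ∈ SmallCircuits ℂ n b, eval (coeffVector (degLEMonomials n) f) (boolSum H') = 0) ∧
        (∀ (t : Fin n → Fin n → ℂ) (c : degLEMonomials n → ℂ),
          eval (uAct t c) (boolSum H') = eval c (boolSum H')) ∧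
        ((∀ α ∈ (boolSum H).support, ∀ m ∈ α.support, ((m : degLEMonomials n) : Fin n →₀ ℕ).degree = n) →
          ∀ α ∈ (boolSum H').support, ∀ m ∈ α.support,
            ((m : degLEMonomials n) : Fin n →₀ ℕ).degree = n) := by
  classical
  obtain ⟨h5, hnN, -, -⟩ := N_arith hn
  obtain ⟨h9, hsq, h13, hcube⟩ := uN_arith hn
  set N := (2 * n).choose n with hNdef
  set E := boolSum H with hEdef
  set HG := genHomH q (pairList n) (rename (Sum.map Sum.inr id) H) with hHGdef
  set G := boolSum HG with hGdef
  have hG : ∀ (s : Fin n → Fin n → ℂ) (c : degLEMonomials n → ℂ),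
      eval (spt s c) G = eval (uAct s c) E := eval_boolSum_genTranslate H
  set D := weightedTotalDegree (heightW n) G with hDdef
  -- `G ≠ 0`, hence `G_top ≠ 0`
  have hGne : G ≠ 0 := by
    intro h0
    apply hne
    refine MvPolynomial.funext fun c => ?_
    rw [map_zero, hEdef, ← uAct_zero c, ← hG, h0, map_zero]
  have hGtop : weightedHomogeneousComponent (heightW n) D G ≠ 0 :=
    weightedHomogeneousComponent_top_ne_zero (heightW n) hGne
  -- the weighted degree is `< 2^N`
  have hK : weightedTotalDegree (heightW n) G < 2 ^ N := by
    refine (weightedTotalDegree_le (heightW n) n heightW_le G).trans_lt ?_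
    refine (Nat.mul_le_mul_right n ((totalDegree_boolSum_le HG).trans
      ((totalDegree_genTranslate_le H).trans (Nat.mul_le_mul_right _ hd)))).trans_lt ?_
    exact u_wdeg_arith hn ha
  -- Fourier extraction of the top root-height component
  obtain ⟨H', hsum', hc', hd'⟩ :=
    exists_boolSum_eq_weightedHomogeneousComponent (heightW n) HG (L := N) (J := D) hK hK
  -- specialise the `s`-variables
  obtain ⟨s₀, hs₀⟩ := exists_aeval_const_ne_zero hGtop
  obtain ⟨lq, lc, ld⟩ := u_level_arith (a := a) (q := q) (c := complexity H) (d := H.totalDegree)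
    h9 hsq h13 hcube hq hc hd
  refine ⟨q + N, lq, aeval (Sum.elim (fun v => rename Sum.inl
    ((Sum.elim (fun p => C (s₀ p)) X :
      (Fin n × Fin n) ⊕ degLEMonomials n → MvPolynomial (degLEMonomials n) ℂ) v))
    (fun j => X (Sum.inr j))) H', ?_, ?_, ?_, ?_, ?_, ?_⟩
  · -- size
    refine (complexity_aeval_le _ _).trans ?_
    have hzero : ∑ v : ((Fin n × Fin n) ⊕ degLEMonomials n) ⊕ Fin (q + N), complexity
        (Sum.elim (fun v => rename Sum.inl ((Sum.elim (fun p => C (s₀ p)) X :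
          (Fin n × Fin n) ⊕ degLEMonomials n → MvPolynomial (degLEMonomials n) ℂ) v))
          (fun j => X (Sum.inr j)) v : MvPolynomial (degLEMonomials n ⊕ Fin (q + N)) ℂ) = 0 := by
      refine Finset.sum_eq_zero fun v _ => ?_
      rcases v with (p | m) | j
      · simp only [Sum.elim_inl, rename_C]; exact complexity_C_holds _
      · simp only [Sum.elim_inl, Sum.elim_inr, rename_X]; exact complexity_X_holds _
      · simp only [Sum.elim_inr]; exact complexity_X_holds _
    rw [hzero, add_zero]
    have hcg : complexity HG ≤ complexity H + n * n * (N * ((n + 1) * (n + 3))) := by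
      have := complexity_genTranslate_le (n := n) H
      rw [card_degLEMonomials, ← hNdef] at this
      exact this
    rw [Fintype.card_sum, Fintype.card_prod, Fintype.card_fin, card_degLEMonomials, ← hNdef] at hc'
    generalize n * n * (N * ((n + 1) * (n + 3))) = A at hcg lc
    generalize (n * n + N) * (3 * N + 1) = B at hc' lc
    omega
  · -- degree
    rw [show aeval _ H' = bind₁ _ H' from rfl]
    refine (Literature.Barriers.ValiantsHypothesis.FSV2018.totalDegree_bind₁_le_mul _ 1 (fun v => ?_)
      H').trans ?_
    · rcases v with (p | m) | j
      · simp only [Sum.elim_inl, rename_C, totalDegree_C]; exact Nat.zero_le _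
      · simp only [Sum.elim_inl, Sum.elim_inr, rename_X, totalDegree_X]; exact le_rfl
      · simp only [Sum.elim_inr, totalDegree_X]; exact le_rfl
    · rw [mul_one]
      have hdg : HG.totalDegree ≤ H.totalDegree * (1 + n * n * n) := totalDegree_genTranslate_le H
      have hdg' : HG.totalDegree * (N + 1) ≤ H.totalDegree * (1 + n * n * n) * (N + 1) :=
        Nat.mul_le_mul_right _ hdg
      omega
  · -- nonzero
    rw [BoolSumComponents.boolSum_aeval_inl, hsum']
    exact hs₀
  · -- vanishing on `SmallCircuits ℂ n b`
    intro f hf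
    rw [BoolSumComponents.boolSum_aeval_inl, hsum', eval_aeval_const]
    refine eval_component_eq_zero_of_forall (fun s => ?_) _ D
    rw [hG, uAct_coeffVector s f hf.1]
    exact eval_eq_zero_of_unipotent (by omega) (b := b + 1) (by omega) hvan s
      (smallCircuits_mono (by omega) (Nat.le_succ b) hf)
  · -- `U`-invariance
    intro t c
    rw [BoolSumComponents.boolSum_aeval_inl, hsum', eval_aeval_const, eval_aeval_const]
    convert eval_top_uAct hG t (fun i j => s₀ (i, j)) c using 2
  · -- top support
    intro htop
    rw [BoolSumComponents.boolSum_aeval_inl, hsum']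
    refine top_of_specialisation (by omega) hG htop (fun α hα => ?_) s₀
    rw [mem_support_iff, coeff_weightedHomogeneousComponent] at hα
    rw [mem_support_iff]
    intro h0; exact hα (by rw [h0, ite_self])

end utop


end Summit.ValiantsHypothesis.ValiantsHypothesis.Theorems.BarrierLever.IsobaricEquations

end
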